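import Summits.ResolutionOfSingularities.ResolutionOfSingularities.Theorems.FrobeniusClosingPatchingRelPerfectCuspMember
import Summits.ResolutionOfSingularities.ResolutionOfSingularities.Theorems.FrobeniusClosingPatchingRelPerfectPointBlowupChartAssembly
import HarnessLib

/-!
# Crux `PatchingRelPerfect` (stmt-ResolutionOfSingularities-16161), chain W5.2 — the TWO-QUADRIC
# member `I = (x₀x₁ − x₂², x₃²) + 𝔪⁴`, part 1: the conic tower (ring level)

[OURS · L1 W5.2 · kernel certificate, res-L1-w52-plan-1 NAMING G11-3 (1) 2026-08-27T15:05:28Z]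
The first MULTI-FORM depth-two graded member whose forms ideal sheaf on `E ≅ ℙ³` is NOT locally
principal (CHAIN v2.9 §3 «not yet covered: multi-form graded ℓ = 2 beyond the locally-principal
case»; (β) `d = 2`, `s = 2`, forms without common factor).  On a Rees chart `B_i` (`i ≠ 3`) of
`Bl_𝔪 Spec S` the member and its two S-avatars become, after twisting off the exceptional
factor `u⁷` (part 2),

  `P · K · J`,  `P = (u, p, v)`,  `K = (v) + (p²) + (u²)`,  `J = (v) + (p², up, u²)`,

where `u` is the exceptional parameter, `p = x₃/x_i`, and `v` is the de-homogenised quadric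
(`e₁ − e₂²`, `e₀ − e₂²`, `e₀e₁ − 1` on the charts of `x₀`, `x₁`, `x₂`): `V(P)` is the CONIC
`C₁ = {x₃ = 0, x₀x₁ = x₂²} ⊂ E`, the cosupport of the residual `K` of the member; `J` is the
residual of the avatar of the second centre.  THIS FILE proves, for every regular ring `A` and
`u, p, v ∈ A` with `(u, p, v)` quasi-regular and `A/(u, p, v)` a regular ring:

* `TwoQuadric.conicTower_isRegular` — **every blowing up of `Spec A` along `(K · J) · P` is a
  regular scheme.**  Chartwise over `Bl_P` (`isRegular_of_isBlowup_mul_of_charts`): on the chart of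
  `v` the residual is the Cartier divisor `(g²)`; on the charts of `u` and of `p` it is
  `g² · N²`, `N = (g, v′)` the exceptional divisor cut by the strict transform of `V(v)` — a
  codimension-two regular centre (the SURFACE `C₂` of the hand tower), whose blowing up is regular
  (`isRegularRing_blowupChart`) and along which `N · 𝒪` is Cartier.

(β-AX) reading (plan-1 G11-3, `MultiHostState` terms, recorded for X3): hosts `𝓐₁ = (ṽ)` (order
`m₁ = 1` along `C₁`), N-member `P̃₃ = V(p)` with exponent `2`, `E` with exponent `2`;
`K = 𝓐₁ ⊔ mono[(P̃₃,2)] ⊔ mono[(E,2)]`; step 1 centre `W = C₁` (a whole COMPONENT of `cosupp K`, rule C3),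
`ν = 1`, successor `K′ = (ṽ′) ⊔ mono[(F₁,1)]` (the summands `p′²F₁`, `u′²F₁` are absorbed by `F₁`);
step 2 centre `W = C₂ = V(ṽ′) ∩ F₁` (a surface component), `ν = 1`, successor `K″ = (1)`: END.
Termination measure read off: (number of non-END components of `cosupp`, max host order) drops
`(1,1) → (1,1) → END` only through the DIMENSION of the centre (curve, then surface) — X3 must
count components of `cosupp K` of each dimension, not orders alone.

Any regular ring, no dimension / characteristic hypothesis; fact-free; nothing here is a statement
of the manuscript under review (AI-written; AI review weaker than expert review).

## References

* Q. Liu, *Algebraic Geometry and Arithmetic Curves*, OUP 2002, Thm. 8.1.19 (a). [Liu2002]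
* The Stacks Project, Tags 080A, 080B, 0804, 0BIQ. [StacksProject]
* U. Görtz, T. Wedhorn, *Algebraic Geometry I* (2nd ed., 2020), Prop. 13.91 (2). [GortzWedhorn2020]
-/

-- `Summit.<Summit>.<Sub>.Theorems` with `Sub = Summit` (single-conjunct summit, D-0017)
set_option linter.dupNamespace false

noncomputable section

open CategoryTheory CategoryTheory.Limits AlgebraicGeometry Literature.AlgebraicGeometry.Resolution
open scoped Pointwise nonZeroDivisors

namespace Summit.ResolutionOfSingularities.ResolutionOfSingularities.Theorems

universe u

namespace TwoQuadric

open CuspMember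

/-! ## Ideal algebra of the three charts of `Bl_P` (any commutative ring) -/

section Algebra

variable {A : Type u} [CommRing A]

/-- `a · 1 = a`, stated over `CommRing` so that the `1` produced by `eq_one_of_eq_mul_self` on a
Rees chart ring is matched syntactically (plain instance path). [folklore] -/
theorem mul_one_cr (a : A) : a * 1 = a := mul_one a

/-- `(X ⊔ (g)) ⊔ (w) = X ⊔ (g)` if `g ∣ w`. [folklore] -/
theorem sup_span_sup_span_of_dvd (X : Ideal A) {g w : A} (hw : g ∣ w) :
    X ⊔ Ideal.span {g} ⊔ Ideal.span {w} = X ⊔ Ideal.span {g} :=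
  le_antisymm (sup_le le_rfl (le_sup_of_le_right (Ideal.span_singleton_le_span_singleton.mpr hw)))
    le_sup_left

/-- `(X ⊔ (w)) ⊔ (g) = X ⊔ (g)` if `g ∣ w`. [folklore] -/
theorem sup_span_sup_span_of_dvd' (X : Ideal A) {g w : A} (hw : g ∣ w) :
    X ⊔ Ideal.span {w} ⊔ Ideal.span {g} = X ⊔ Ideal.span {g} :=
  le_antisymm (sup_le (sup_le le_sup_left
    (le_sup_of_le_right (Ideal.span_singleton_le_span_singleton.mpr hw))) le_sup_right)
    (sup_le_sup_right le_sup_left _)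

/-- **`v`-chart** (`v = g`, `p = g p′`, `u = g u′`): `K = (g, (g p′)², (g u′)²) = (g)`. [folklore] -/
theorem vChart_K (g p' u' : A) :
    Ideal.span {g} ⊔ Ideal.span {(g * p') ^ 2} ⊔ Ideal.span {(g * u') ^ 2} = Ideal.span {g} :=
  span_sup_sup_eq ⟨g * p' ^ 2, by ring⟩ ⟨g * u' ^ 2, by ring⟩

/-- **`v`-chart**: `J = (g, (g p′)², (g u′)(g p′), (g u′)²) = (g)`. [folklore] -/
theorem vChart_J (g p' u' : A) :
    Ideal.span {g} ⊔ Ideal.span {(g * p') ^ 2} ⊔ Ideal.span {g * u' * (g * p')} ⊔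
      Ideal.span {(g * u') ^ 2} = Ideal.span {g} := by
  rw [span_sup_sup_eq ⟨g * p' ^ 2, by ring⟩ ⟨u' * g * p', by ring⟩]
  exact span_sup_eq ⟨g * u' ^ 2, by ring⟩

/-- **`p`-chart** (`p = g`, `u = g u′`, `v = g v′`): `K = (g v′, g², (g u′)²) = g · ((v′) + (g))`.
[folklore] -/
theorem pChart_K (g u' v' : A) :
    Ideal.span {g * v'} ⊔ Ideal.span {g ^ 2} ⊔ Ideal.span {(g * u') ^ 2} =
      Ideal.span {g} * (Ideal.span {v'} ⊔ Ideal.span {g}) := by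
  rw [sup_span_sup_span_of_dvd _ (⟨u' ^ 2, by ring⟩ : g ^ 2 ∣ (g * u') ^ 2), pow_two,
    Ideal.mul_sup, Ideal.span_singleton_mul_span_singleton, Ideal.span_singleton_mul_span_singleton]

/-- **`p`-chart**: `J = (g v′, g², (g u′) g, (g u′)²) = g · ((v′) + (g))`. [folklore] -/
theorem pChart_J (g u' v' : A) :
    Ideal.span {g * v'} ⊔ Ideal.span {g ^ 2} ⊔ Ideal.span {g * u' * g} ⊔ Ideal.span {(g * u') ^ 2} =
      Ideal.span {g} * (Ideal.span {v'} ⊔ Ideal.span {g}) := by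
  rw [sup_span_sup_span_of_dvd _ (⟨u', by ring⟩ : g ^ 2 ∣ g * u' * g),
    sup_span_sup_span_of_dvd _ (⟨u' ^ 2, by ring⟩ : g ^ 2 ∣ (g * u') ^ 2), pow_two,
    Ideal.mul_sup, Ideal.span_singleton_mul_span_singleton, Ideal.span_singleton_mul_span_singleton]

/-- **`u`-chart** (`u = g`, `p = g p′`, `v = g v′`): `K = (g v′, (g p′)², g²) = g · ((v′) + (g))`.
[folklore] -/
theorem uChart_K (g p' v' : A) :
    Ideal.span {g * v'} ⊔ Ideal.span {(g * p') ^ 2} ⊔ Ideal.span {g ^ 2} =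
      Ideal.span {g} * (Ideal.span {v'} ⊔ Ideal.span {g}) := by
  rw [pow_two g, sup_span_sup_span_of_dvd' _ (⟨p' ^ 2, by ring⟩ : g * g ∣ (g * p') ^ 2),
    Ideal.mul_sup, Ideal.span_singleton_mul_span_singleton, Ideal.span_singleton_mul_span_singleton]

/-- **`u`-chart**: `J = (g v′, (g p′)², g (g p′), g²) = g · ((v′) + (g))`. [folklore] -/
theorem uChart_J (g p' v' : A) :
    Ideal.span {g * v'} ⊔ Ideal.span {(g * p') ^ 2} ⊔ Ideal.span {g * (g * p')} ⊔ Ideal.span {g ^ 2} =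
      Ideal.span {g} * (Ideal.span {v'} ⊔ Ideal.span {g}) := by
  rw [pow_two g, sup_span_sup_span_of_dvd' _ (⟨p', by ring⟩ : g * g ∣ g * (g * p')),
    sup_span_sup_span_of_dvd' _ (⟨p' ^ 2, by ring⟩ : g * g ∣ (g * p') ^ 2),
    Ideal.mul_sup, Ideal.span_singleton_mul_span_singleton, Ideal.span_singleton_mul_span_singleton]

/-- Collecting: `(g N) (g N) = g² · (N N)`. [folklore] -/
theorem collect_sq (g : A) (N : Ideal A) :
    Ideal.span {g} * N * (Ideal.span {g} * N) = Ideal.span {g ^ 2} * (N * N) := by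
  rw [pow_two, ← Ideal.span_singleton_mul_span_singleton]; ring

end Algebra

/-! ## The blowing up of a codimension-two regular centre `N = (g, w)` along `N · N` -/

section CodimTwo

variable {B : Type u} [CommRing B] [IsRegularRing B] (g w : B)

/-- **Every blowing up of `Spec B` along `N²`, `N = (g, w)` quasi-regular with `B/N` regular
(`B` regular), is a regular scheme**: it is the blowing up along `N` (regular, Stacks 0BIQ /
Liu 8.1.19 (a)) followed by the blowing up of the Cartier divisor `N · 𝒪` (an isomorphism).
[cite: Liu2002, Thm. 8.1.19 (a)] [cite: StacksProject, Tag 080A] -/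
theorem isRegular_of_isBlowup_pair_sq (hq : IsQuasiRegular (![g, w] : Fin 2 → B))
    (hreg : IsRegularRing (B ⧸ Ideal.span (Set.range (![g, w] : Fin 2 → B))))
    {Y : Scheme.{u}} {ρ : Y ⟶ Spec (.of B)}
    (hρ : IsBlowup ρ (affineBlowup.idealSheaf
      ((Ideal.span {g} ⊔ Ideal.span {w}) * (Ideal.span {g} ⊔ Ideal.span {w})))) :
    Scheme.IsRegular Y := by
  rw [← span_range_vec2 g w] at hρ
  haveI := hreg
  refine isRegular_of_isBlowup_mul_of_charts (![g, w] : Fin 2 → B) (Ideal.span (Set.range (![g, w] : Fin 2 → B)))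
    (fun k Y' ρ' hρ' => ?_) hρ
  haveI hBk : IsRegularRing (chartRing (![g, w] : Fin 2 → B) k) := isRegularRing_blowupChart _ k hq
  rw [map_reesChartBase_eq ((![g, w] : Fin 2 → B) k)
    (Ideal.mem_span_range_self (f := (![g, w] : Fin 2 → B)) (x := k))] at hρ'
  exact isRegular_of_isBlowup_span_singleton_nzd
    (reesChartBase_mem_nonZeroDivisors ((![g, w] : Fin 2 → B) k)
      (Ideal.mem_span_range_self (f := (![g, w] : Fin 2 → B)) (x := k))) hρ'

end CodimTwo

/-! ## The conic tower over `Bl_P`, `P = (u, p, v)` -/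

section Tower

variable {A : Type u} [CommRing A] [IsRegularRing A] (u p v : A)

/-- The centre `P = (u, p, v)` as a family. -/
local notation3 "xx" => (![u, p, v] : Fin 3 → A)
/-- The residual of the member: `K = (v) + (p²) + (u²)`. -/
local notation3 "KK" => (Ideal.span {v} ⊔ Ideal.span {p ^ 2} ⊔ Ideal.span {u ^ 2})
/-- The residual of the second avatar: `J = (v) + (p², up, u²)`. -/
local notation3 "JJ" =>
  (Ideal.span {v} ⊔ Ideal.span {p ^ 2} ⊔ Ideal.span {u * p} ⊔ Ideal.span {u ^ 2})

omit [IsRegularRing A] in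
/-- On the chart of index `j` of `Bl_P`, the chart family `(g, e_k)` for one further index
`k ≠ j` is `![g, e_k]`. [folklore] -/
theorem cons_eq_vec2 (j : Fin 3) (k : {k : Fin 3 // k ≠ j}) :
    (Fin.cons (chartBase xx j (xx j)) fun _ : Fin 1 => chartGen xx j k.1 : Fin 2 → chartRing xx j) =
      ![chartBase xx j (xx j), chartGen xx j k.1] := by
  funext l
  refine Fin.cases rfl (fun l => ?_) l
  fin_cases l; rfl

omit [IsRegularRing A] in
/-- **Persistence to a chart**: for `(u, p, v)` quasi-regular with `A/(u,p,v)` regular, on the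
chart of index `j` the pair `(g, e_k)` (`k ≠ j`) is quasi-regular with regular quotient
(the chart family of `…CoreRungTowerCharts`). [cite: StacksProject, Tag 0BIQ] -/
theorem pair_hyp (hq : IsQuasiRegular xx) [IsRegularRing (A ⧸ Ideal.span (Set.range xx))]
    (j : Fin 3) (k : {k : Fin 3 // k ≠ j}) :
    IsQuasiRegular (![chartBase xx j (xx j), chartGen xx j k.1] : Fin 2 → chartRing xx j) ∧
    IsRegularRing (chartRing xx j ⧸ Ideal.span (Set.range
      (![chartBase xx j (xx j), chartGen xx j k.1] : Fin 2 → chartRing xx j))) := by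
  have hjJ : Function.Injective (fun _ : Fin 1 => k) := fun a b _ => Subsingleton.elim a b
  refine ⟨?_, ?_⟩
  · have h := CoreRungTower.isQuasiRegular_chartFamily xx j (fun _ : Fin 1 => k) hq hjJ
    rwa [cons_eq_vec2] at h
  · have h := CoreRungTower.isRegularRing_quot_chartFamily xx j (fun _ : Fin 1 => k) hq
    rwa [cons_eq_vec2] at h

set_option maxHeartbeats 400000 in
-- instance-path defeq through `HomogeneousLocalization`'s standalone `Mul`/`Pow`/`One` (as in p508825)
/-- **THE CONIC TOWER (ring level).** For every regular ring `A` and `u, p, v ∈ A` with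
`(u, p, v)` quasi-regular and `A/(u, p, v)` regular, every blowing up of `Spec A` along
`(K · J) · P`, `P = (u,p,v)`, `K = (v) + (p²) + (u²)`, `J = (v) + (p², up, u²)`, is a regular
scheme: `Bl_P` (regular centre), then on its `u`- and `p`-charts the blowing up of the
codimension-two regular centre `(g, v′)` (twice the same centre: `N²`), on its `v`-chart nothing.
[cite: Liu2002, Thm. 8.1.19 (a)] [cite: StacksProject, Tag 080A] [cite: StacksProject, Tag 0BIQ] -/
theorem conicTower_isRegular (hq : IsQuasiRegular xx)
    (hreg : IsRegularRing (A ⧸ (Ideal.span {u} ⊔ Ideal.span {p} ⊔ Ideal.span {v})))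
    {Y : Scheme.{u}} {f : Y ⟶ Spec (.of A)}
    (hf : IsBlowup f (affineBlowup.idealSheaf
      ((KK * JJ) * (Ideal.span {u} ⊔ Ideal.span {p} ⊔ Ideal.span {v})))) :
    Scheme.IsRegular Y := by
  rw [← span_range_vec3 u p v] at hf
  haveI hAx : IsRegularRing (A ⧸ Ideal.span (Set.range xx)) := by
    rw [span_range_vec3 u p v]; exact hreg
  refine isRegular_of_isBlowup_mul_of_charts xx (KK * JJ) (fun j Y' ρ hρ => ?_) hf
  haveI hB : IsRegularRing (chartRing xx j) := isRegularRing_blowupChart xx j hq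
  have hg : chartBase xx j (xx j) ∈ (chartRing xx j)⁰ :=
    reesChartBase_mem_nonZeroDivisors (xx j) (Ideal.mem_span_range_self (f := xx) (x := j))
  have he : chartGen xx j j = 1 := eq_one_of_eq_mul_self hg (reesChartBase_apply_eq_mul_chartGen xx j j)
  have hj : j = 0 ∨ j = 1 ∨ j = 2 := by
    fin_cases j
    · exact Or.inl rfl
    · exact Or.inr (Or.inl rfl)
    · exact Or.inr (Or.inr rfl)
  -- the images of `u, p, v` on the chart
  have cu : chartBase xx j u = chartBase xx j (xx j) * chartGen xx j 0 :=
    reesChartBase_apply_eq_mul_chartGen xx j 0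
  have cp : chartBase xx j p = chartBase xx j (xx j) * chartGen xx j 1 :=
    reesChartBase_apply_eq_mul_chartGen xx j 1
  have cv : chartBase xx j v = chartBase xx j (xx j) * chartGen xx j 2 :=
    reesChartBase_apply_eq_mul_chartGen xx j 2
  rw [Ideal.map_mul, Ideal.map_sup, Ideal.map_sup, Ideal.map_sup, Ideal.map_sup, Ideal.map_sup,
    map_span_singleton, map_span_singleton, map_span_singleton, map_span_singleton, map_pow, map_pow,
    map_mul, cu, cp, cv] at hρ
  rcases hj with rfl | rfl | rfl
  · -- `u`-chart: `g = u/1`, residual `g² · N²`, `N = (v′, g)`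
    rw [he, mul_one_cr (A := chartRing xx 0), uChart_K (A := chartRing xx 0),
      uChart_J (A := chartRing xx 0), collect_sq (A := chartRing xx 0)] at hρ
    obtain ⟨hq2, hreg2⟩ := pair_hyp u p v hq 0 ⟨2, by decide⟩
    refine CoreRungTower.isRegular_of_isBlowup_span_singleton_mul (pow_mem hg 2) _ (fun Y'' ρ' hρ' => ?_) hρ
    rw [sup_comm] at hρ'
    exact isRegular_of_isBlowup_pair_sq _ _ hq2 hreg2 hρ'
  · -- `p`-chart: `g = p/1`, residual `g² · N²`, `N = (v′, g)`
    rw [he, mul_one_cr (A := chartRing xx 1), pChart_K (A := chartRing xx 1),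
      pChart_J (A := chartRing xx 1), collect_sq (A := chartRing xx 1)] at hρ
    obtain ⟨hq2, hreg2⟩ := pair_hyp u p v hq 1 ⟨2, by decide⟩
    refine CoreRungTower.isRegular_of_isBlowup_span_singleton_mul (pow_mem hg 2) _ (fun Y'' ρ' hρ' => ?_) hρ
    rw [sup_comm] at hρ'
    exact isRegular_of_isBlowup_pair_sq _ _ hq2 hreg2 hρ'
  · -- `v`-chart: `g = v/1`, residual `(g) · (g)` is Cartier
    rw [he, mul_one_cr (A := chartRing xx 2), vChart_K (A := chartRing xx 2),
      vChart_J (A := chartRing xx 2), Ideal.span_singleton_mul_span_singleton] at hρ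
    exact isRegular_of_isBlowup_span_singleton_nzd (mul_mem hg hg) hρ

end Tower

end TwoQuadric

end Summit.ResolutionOfSingularities.ResolutionOfSingularities.Theorems

end
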